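import Summits.BirchSwinnertonDyer.BirchSwinnertonDyer.Theorems.EisensteinDepletionAtTwoStarOptBNSFStubOddIsoTwoAdic
import HarnessLib

/-!
# Line `nsf` on crux `StarOptBNSF` (item stmt-BirchSwinnertonDyer-27047): an odd-degree `ℚ`-isogeny
# transports a FORMAL rational 2-torsion point to a FORMAL rational 2-torsion point (no uniqueness hypothesis)

Lead bsd-rank2-star-p1 GEN 8.  The registered stub `stub_oddIsoTwoAdic` (lead GEN 7, planner p2 GEN 32) is
stated for curves with a UNIQUE rational point of order `2` on both sides.  For the typed re-cut of the research
stub `stub_thmAShadow` (planner p2 GEN 33, STEVENS-AT-TWO.md §5: «Stevens' conjecture at `ℓ = 2` for the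
`X₁(N)`-optimal curve» + the print existence of that curve + kernel glue) one needs the same 2-adic transport
WITHOUT uniqueness: the `X₀(N)`-optimal curve `W₀` of a habitat class may have full rational 2-torsion.

* `twoTorsionRamifiedAtTwo_iff_of_isogeny_apply_eq` — for `φ : W → W′` of ODD degree between globally minimal
  curves, `W` good ordinary at `2`, and rational points `T = (x, y)`, `T′ = (x′, y′)` of order `2` with
  `φ T = T′` (on geometric points): `v₂(x) < 0 ↔ v₂(x′) < 0` (GEN 7's inertia core `helper_localRed_twoTorsion_iff`
  — the μ₂-point goes to the μ₂-point — read through the dictionary `helper_localRed_ratPoint_eq_zero_iff`).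
* `exists_apply_eq_of_isogeny_of_odd` — the image of a rational point of order `2` under an odd-degree
  `ℚ`-isogeny is (the geometric point of) a rational point of order `2` (Galois descent; `φ` does not kill `T`).
* `exists_ramified_twoTorsion_of_isogeny_of_odd` — hence a FORMAL rational 2-torsion abscissa of `W` gives one
  of `W′`; contrapositive `not_exists_ramified_of_isogeny_of_odd`: if `W′` has none, `W` has none.

HONEST FRAMING: helpers for a re-cut of the research stub of an OPEN crux; `StarOptBNSF` (27047) / `E1M_NSF`
(27021) / BSD are NOT proved by them; nothing here reads an analytic rank.

References: R. Greenberg, LNM 1716 (1999), §5 p. 168 [GreenbergLNM1716]; R. Greenberg, V. Vatsal, Invent. Math.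
142 (2000), §2 p. 26 [GreenbergVatsal2000]; J. H. Silverman, *AEC*, GTM 106 (2009), III.4.8, III.6.1, VII.2
[SilvermanAEC2009].
-/

set_option linter.dupNamespace false
set_option autoImplicit false

noncomputable section

open scoped Classical
open NumberField IsDedekindDomain Field
open Literature.NumberTheory.EllipticCurves Literature.NumberTheory.EllipticCurves.Greenberg1999
open WeierstrassCurve (minimalDiscriminantInt)
open Summit.BirchSwinnertonDyer.Rank1Residual.X2.GreenbergVatsalReductionDatum (localRed)
open Summit.BirchSwinnertonDyer.BirchSwinnertonDyer.Theorems.DepletionAtTwo.OddIsoTwoAdic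
open Summit.BirchSwinnertonDyer.BirchSwinnertonDyer.Theorems.DepletionAtTwo.ArchTransport
open Summit.BirchSwinnertonDyer.BirchSwinnertonDyer.Theorems.DepletionAtTwo.NsfStubs

namespace Summit.BirchSwinnertonDyer.BirchSwinnertonDyer.Theorems.DepletionAtTwo.OddTransportRamified

variable {W W' : WeierstrassCurve ℚ}

/-- **The image of a rational point of order `2` under an odd-degree `ℚ`-isogeny is a rational point of order
`2`.**  `φ T` is `Γ_ℚ`-fixed (equivariance), hence the geometric point of a rational point (Galois descent,
`exists_toGeomPoints_eq_of_forall_smul_eq`); it is not `O` because `deg φ` is odd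
(`isogeny_apply_ne_zero_of_odd`), and it is killed by `2`. [cite: SilvermanAEC2009, III.4.8 and III.6.1(a)] -/
theorem exists_apply_eq_of_isogeny_of_odd [W.IsElliptic] [W'.IsElliptic] (φ : WeierstrassCurve.Isogeny W W')
    (hodd : Odd φ.degree) {x y : ℚ} (hT : W.toAffine.Nonsingular x y) (h2 : 2 * y + W.a₁ * x + W.a₃ = 0) :
    ∃ (x' y' : ℚ) (hT' : W'.toAffine.Nonsingular x' y'),
      φ (W.toGeomPoints (.some x y hT)) = W'.toGeomPoints (.some x' y' hT') ∧
        2 * y' + W'.a₁ * x' + W'.a₃ = 0 := by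
  have hfix : ∀ σ : Field.absoluteGaloisGroup ℚ,
      σ • φ (W.toGeomPoints (.some x y hT)) = φ (W.toGeomPoints (.some x y hT)) := fun σ ↦ by
    rw [← φ.map_smul, WeierstrassCurve.smul_toGeomPoints]
  obtain ⟨P, hP⟩ := WeierstrassCurve.exists_toGeomPoints_eq_of_forall_smul_eq W' hfix
  rcases P with _ | ⟨x₁, y₁, h₁⟩
  · exact absurd (show φ (W.toGeomPoints (.some x y hT)) = 0 by rw [← hP]; rfl)
      (isogeny_apply_ne_zero_of_odd φ hodd hT h2)
  exact ⟨x₁, y₁, h₁, hP.symm, two_torsion_of_isogeny_apply_eq φ hT h₁ h2 hP.symm⟩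

/-- **An odd-degree isogeny preserves «ramified at 2» for ANY rational 2-torsion point it carries.**  For
`φ : W → W′` of odd degree between globally minimal elliptic curves over `ℚ`, `W` good ordinary at `2`, and
rational points `T = (x, y)`, `T′ = (x′, y′)` of order `2` with `φ T = T′`:
`TwoTorsionRamifiedAtTwo x ↔ TwoTorsionRamifiedAtTwo x′`.  The inertia core is GEN 7's
`helper_localRed_twoTorsion_iff` (the μ₂-point of the ordinary curve goes to the μ₂-point), read through the
dictionary `helper_localRed_ratPoint_eq_zero_iff` (`red_v = 0 ↔ v₂(x) < 0`). [cite: GreenbergLNM1716, §5 p. 168]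
[cite: GreenbergVatsal2000, §2 p. 26] -/
theorem twoTorsionRamifiedAtTwo_iff_of_isogeny_apply_eq [W.IsElliptic] [W.IsGloballyMinimal] [W'.IsElliptic]
    [W'.IsGloballyMinimal] (φ : WeierstrassCurve.Isogeny W W') (hodd : Odd φ.degree) (hord : IsOrdinaryAt W 2)
    {x y x' y' : ℚ} (hT : W.toAffine.Nonsingular x y) (hT' : W'.toAffine.Nonsingular x' y')
    (h2 : 2 * y + W.a₁ * x + W.a₃ = 0)
    (hφ : φ (W.toGeomPoints (.some x y hT)) = W'.toGeomPoints (.some x' y' hT')) :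
    TwoTorsionRamifiedAtTwo x ↔ TwoTorsionRamifiedAtTwo x' := by
  obtain ⟨v, hpv⟩ := exists_natCast_mem_asIdeal Nat.prime_two
  have hiso : WeierstrassCurve.IsIsogenous W W' := ⟨φ⟩
  have hord' : IsOrdinaryAt W' 2 :=
    Summit.BirchSwinnertonDyer.BirchSwinnertonDyer.Theorems.IsogenyMuShift.isOrdinaryAt_of_isIsogenous hiso hord
  have hΔ : ¬ (2 : ℤ) ∣ minimalDiscriminantInt W :=
    W.not_dvd_minimalDiscriminantInt_of_hasGoodReductionAtPrime' 2 hord.1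
  have hΔ' : ¬ (2 : ℤ) ∣ minimalDiscriminantInt W' :=
    W'.not_dvd_minimalDiscriminantInt_of_hasGoodReductionAtPrime' 2 hord'.1
  have hord2 : ¬ (2 : ℤ) ∣ W.frobeniusTrace 2 := by exact_mod_cast hord.2
  have hord2' : ¬ (2 : ℤ) ∣ W'.frobeniusTrace 2 := by exact_mod_cast hord'.2
  obtain ⟨hC, hG⟩ := toGeomPoints_some W hT
  obtain ⟨hC', hG'⟩ := toGeomPoints_some W' hT'
  have hT2 : W.toGeomPoints (.some x y hT) + W.toGeomPoints (.some x y hT) = 0 :=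
    toGeomPoints_add_self_eq_zero W hT h2
  have hT0 : W.toGeomPoints (.some x y hT) ≠ 0 := toGeomPoints_some_ne_zero' W hT
  have hP2 : pointsMap W (v.adicCompletion ℚ) (W.toGeomPoints (.some x y hT)) +
      pointsMap W (v.adicCompletion ℚ) (W.toGeomPoints (.some x y hT)) = 0 := by
    rw [← map_add, hT2, map_zero]
  have hP0 : pointsMap W (v.adicCompletion ℚ) (W.toGeomPoints (.some x y hT)) ≠ 0 := by
    intro hz
    apply hT0
    have hinj := pointsMapOfEmb_injective W (closureEmb (K := ℚ) (v.adicCompletion ℚ))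
    apply hinj
    change pointsMap W (v.adicCompletion ℚ) (W.toGeomPoints (.some x y hT)) =
      pointsMap W (v.adicCompletion ℚ) 0
    rw [map_zero]
    exact hz
  have hcore := helper_localRed_twoTorsion_iff W W' φ hodd hpv hΔ hΔ' hord2 hord2' _ hP2 hP0
  have hmap : φ.localPointsMap (v.adicCompletion ℚ)
      (pointsMap W (v.adicCompletion ℚ) (W.toGeomPoints (.some x y hT))) =
      pointsMap W' (v.adicCompletion ℚ) (W'.toGeomPoints (.some x' y' hT')) := by
    rw [WeierstrassCurve.Isogeny.localPointsMap_pointsMap, hφ]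
  rw [hmap, hG, hG'] at hcore
  rw [← helper_localRed_ratPoint_eq_zero_iff W hpv hΔ x y hC,
    ← helper_localRed_ratPoint_eq_zero_iff W' hpv hΔ' x' y' hC']
  exact hcore

/-- **A FORMAL rational 2-torsion point goes to a FORMAL rational 2-torsion point under an odd-degree
`ℚ`-isogeny** (globally minimal models, `W` good ordinary at `2`; no uniqueness of the rational 2-torsion is
assumed on either side). [cite: GreenbergLNM1716, §5 p. 168] [cite: SilvermanAEC2009, III.6.1(a)] -/
theorem exists_ramified_twoTorsion_of_isogeny_of_odd [W.IsElliptic] [W.IsGloballyMinimal] [W'.IsElliptic]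
    [W'.IsGloballyMinimal] (φ : WeierstrassCurve.Isogeny W W') (hodd : Odd φ.degree) (hord : IsOrdinaryAt W 2)
    {x : ℚ} (hx : HasRationalTwoTorsionX W x) (hram : TwoTorsionRamifiedAtTwo x) :
    ∃ x' : ℚ, HasRationalTwoTorsionX W' x' ∧ TwoTorsionRamifiedAtTwo x' := by
  obtain ⟨y, hxy, h2⟩ := hx
  have hT : W.toAffine.Nonsingular x y := (WeierstrassCurve.Affine.equation_iff_nonsingular).mp hxy
  obtain ⟨x', y', hT', hφ, h2'⟩ := exists_apply_eq_of_isogeny_of_odd φ hodd hT h2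
  exact ⟨x', ⟨y', hT'.left, h2'⟩,
    (twoTorsionRamifiedAtTwo_iff_of_isogeny_apply_eq φ hodd hord hT hT' h2 hφ).mp hram⟩

/-- **Contrapositive, the shape the line consumes.**  If the target of an odd-degree `ℚ`-isogeny (globally
minimal models, source good ordinary at `2`) has NO formal rational 2-torsion point, neither has the source.
[cite: GreenbergLNM1716, §5 p. 168] -/
theorem not_exists_ramified_of_isogeny_of_odd [W.IsElliptic] [W.IsGloballyMinimal] [W'.IsElliptic]
    [W'.IsGloballyMinimal] (φ : WeierstrassCurve.Isogeny W W') (hodd : Odd φ.degree) (hord : IsOrdinaryAt W 2)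
    (hno' : ¬ ∃ x' : ℚ, HasRationalTwoTorsionX W' x' ∧ TwoTorsionRamifiedAtTwo x') :
    ¬ ∃ x : ℚ, HasRationalTwoTorsionX W x ∧ TwoTorsionRamifiedAtTwo x := by
  rintro ⟨x, hx, hram⟩
  exact hno' (exists_ramified_twoTorsion_of_isogeny_of_odd φ hodd hord hx hram)

end Summit.BirchSwinnertonDyer.BirchSwinnertonDyer.Theorems.DepletionAtTwo.OddTransportRamified

end
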